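import Mathlib
import Literature.Probability.LatticeModels.RegularScales
import Literature.Probability.LatticeModels.IsingThermodynamics
import Literature.Probability.LatticeModels.CorrelationInequalities
import Literature.Probability.LatticeModels.DoubleCurrentsInfinite
import Literature.Probability.LatticeModels.GibbsTailConditioning
import Literature.Probability.LatticeModels.ProductTailTriviality
import Summits.CriticalPhenomena.Ising3DConformalLimit.Theses.EnergyNotSigmaSquared

/-!
# Sketch — first lemmas of the crux-idea cards for `RungOneAdjacentMerging`
(item stmt-CriticalPhenomena-11262; planner-cruxidea-…-11262-3-0, round 1)

Nothing here is proved except the elementary reductions marked `theorem`; the `def … : Prop`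
are the FIRST LEMMAS of the cards, stated over existing declarations so that they elaborate.
-/

namespace Summit.CriticalPhenomena.Ising3DConformalLimit.Cruxes.RungOneAdjacentMerging.Sketch

open Literature.Probability.LatticeModels Finset Filter
open scoped BigOperators Topology

/-! ## Card `toward-cone-chebyshev` -/

/-- **First lemma (MMS toward-cone monotonicity).** For the n.n. Ising plus-state two-point
function `S = ⟨σ₀σ_·⟩⁺_β` on `ℤ^d`, `β ≥ 0`: let `x` lie in the closed positive orthant with
largest coordinate `x i₀`; if `u` points into the *toward-cone* of `x` — `u l ≥ 0` on every
coordinate `l` carrying more than half of `x i₀`, the off-`i₀` mass of `u` is at most `u i₀`,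
and `4‖u‖₁ ≤ x i₀` — then `S (x - u) ≥ S x`.  Proof sketch: from `y = x - u` reach `x` by
`S`-non-increasing moves only: diagonal Messager–Miracle-Solé moves `z ↦ z + e_{i₀} ± e_l`
(`messager_miracleSole_diag`, valid while `∓ z l ≤ z i₀`) clear the small coordinates, then
axis moves `z ↦ z + e_l` (`messager_miracleSole`, valid while `z l ≥ 0`).  General `x` reduce
to the orthant by `twoPointPlus_reflection_invariant`.  Consequence used by the card: the
far-point tilt `h(u) = S(x-u)/S(x)` is `≥ 1` on a solid cone, for EVERY far `x`, with no
regularity of `S` at scale `‖x‖`. -/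
def TowardConeMonotone (d : ℕ) (β : ℝ) : Prop :=
  ∀ (x u : Site d) (i₀ : Fin d),
    (∀ l, 0 ≤ x l) → (∀ l, x l ≤ x i₀) →
    (∀ l, x i₀ < 2 * x l → 0 ≤ u l) →
    (∑ l ∈ univ.erase i₀, |u l|) ≤ u i₀ →
    4 * (∑ l, |u l|) ≤ x i₀ →
    twoPointPlus d β x ≤ twoPointPlus d β (x - u)

/-- The instance consumed by the card: `d = 3`, `β = β_c(3)`. -/
def CriticalTowardCone : Prop := TowardConeMonotone 3 (criticalBeta 3)

/-- The trivial sub-case already in reach of the tree's axis lemma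
(`twoPointPlus_add_single_le`): coordinatewise between `0` and `x`. Recorded as the unit test
of the statement's orientation. -/
def OrthantBetweenMonotone (d : ℕ) (β : ℝ) : Prop :=
  ∀ (x y : Site d), (∀ i, (0 ≤ y i ∧ y i ≤ x i) ∨ (x i ≤ y i ∧ y i ≤ 0)) →
    twoPointPlus d β x ≤ twoPointPlus d β y

/-- Squared two-point mass of the dyadic shell `k`: `a_k = ∑_{2^k ≤ ‖v‖_∞ ≤ 2^{k+1}} S(v)²`. -/
noncomputable def shellSq (k : ℕ) : ℝ :=
  ∑ v ∈ ann 3 (2 ^ k) (2 ^ (k + 1)), criticalTwoPoint 3 v ^ 2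

/-- Truncated bubble `s_k = B_{2^k} = ∑_{‖v‖_∞ ≤ 2^k} S(v)²` (diverges as `k → ∞` on `ℤ³`,
Duminil-Copin–Panis 2025 Thm 1.8, in tree `NNIsing.bubbleDiagram_criticalBeta_three_eq_top`). -/
noncomputable def bubbleTo (k : ℕ) : ℝ :=
  ∑ v ∈ box 3 (2 ^ k), criticalTwoPoint 3 v ^ 2

open Classical in
/-- **Support crux of the card (bubble harvest along a spaced regular family).** There is a
family `𝒦` of `(c,C)`-regular dyadic scales (ADC 2021 Def. 5.11, `IsRegularScale`), pairwise
separated by the factor `C + 2`, along which the per-shell Paley–Zygmund efficiencies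
`e_k ≍ a_k / s_{k+2}` are NOT summable.  (Abel–Dini gives `∑_k a_k/s_k = ∞` over ALL scales from
`s_k → ∞`; the content is that a positive share of the bubble's growth sits at regular scales —
`isRegularScale_of_growth` says growth scales of `χ` are regular; the bubble version is the
item.) -/
def RegularBubbleHarvest : Prop :=
  ∃ c C : ℝ, 0 < c ∧ 0 < C ∧ ∃ 𝒦 : Set ℕ,
    (∀ k ∈ 𝒦, IsRegularScale (criticalTwoPoint 3) c C (2 ^ k)) ∧
    (∀ k ∈ 𝒦, ∀ k' ∈ 𝒦, k < k' → (C + 2) * (2 : ℝ) ^ k < (2 : ℝ) ^ k') ∧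
    Tendsto (fun N : ℕ => ∑ k ∈ (Finset.range N).filter (· ∈ 𝒦), shellSq k / bubbleTo (k + 2))
      atTop atTop

/-- **The abstract Chebyshev step of the card** (pure real-variable/probability bookkeeping,
recorded as the shape the prover will need): for nonnegative random counts `N k` with means
`m k > 0`, efficiencies `e k = m k ^ 2 / 𝔼[N k ^ 2] ∈ (0,1]`, cross ratios
`ρ j k = 𝔼[N j * N k]/(m j * m k) ≤ 1 + ε (|j - k|)` with `ε → 0` and `ρ ≤ Cρ` always, and
`∑ e k = ∞`, the weighted count `Z_n = ∑_{k ≤ n} e k * N k / m k` has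
`Var Z_n / (𝔼 Z_n)² → 0`, hence `ℙ[∀ k ≤ n, N k = 0] → 0`.  Stated here for real sequences as the
inequality it reduces to. -/
def WeightedChebyshevShape : Prop :=
  ∀ (e : ℕ → ℝ) (ρ : ℕ → ℕ → ℝ) (ε : ℕ → ℝ) (Cρ : ℝ),
    (∀ k, 0 < e k ∧ e k ≤ 1) → (∀ j k, ρ j k ≤ Cρ) → (∀ j k, j ≠ k → ρ j k ≤ 1 + ε (Nat.dist j k)) →
    Tendsto ε atTop (𝓝 0) → Tendsto (fun n => ∑ k ∈ Finset.range n, e k) atTop atTop →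
    Tendsto (fun n =>
      ((∑ k ∈ Finset.range n, e k) +
        ∑ j ∈ Finset.range n, ∑ k ∈ Finset.range n, if j = k then 0 else e j * e k * (ρ j k - 1)) /
        (∑ k ∈ Finset.range n, e k) ^ 2) atTop (𝓝 0)

/-! ## Card `birooted-limit-zero-one` -/

/-- **First lemma, warm-up object (tail triviality of the critical sourceless double current on
`ℤ³`).**  The ADS15 infinite-volume double current `ℙ_{β_c}` (`adsDoubleCurrentLawInf`, in tree
with R1/R2/R3 = existence, shift invariance, mixing under translations) is trivial on the tail
σ-algebra of bond configurations (`IsTailTrivial`, Georgii–Higuchi vocabulary of the tree).  The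
card's real object is the ONE-ARMED sourced analogue (subsequential local limits of
`P^{0x,∅}` as `‖x‖ → ∞`), for which no declaration exists yet (definition request); this is the
sourceless half of that statement and the first thing a prover can attack (route: Lupu–Werner /
Grimmett–Janson coupling to FK-Ising, extremality of the unique critical FK measure, absence of
percolation `ads_percolatesAt_zero_of_lroTildeSq`). -/
def SourcelessTailTrivial : Prop :=
  IsTailTrivial (V := Sym2 (Site 3)) (S := Prop) (adsDoubleCurrentLawInf 3 (criticalBeta 3))

/-- **The two-sided zero–one shape** the card rests on is the tree's `IsTailTrivial.prod`
(Georgii–Higuchi 2000, Lemma 5.4): under a product of two tail-trivial laws every product-tail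
event has probability `0` or `1`.  Recorded as the implication the card needs, for an abstract
pair of laws on bond configurations of `ℤ³`. -/
def ProductTailZeroOne : Prop :=
  ∀ (μ μ' : MeasureTheory.Measure (Sym2 (Site 3) → Prop)) [MeasureTheory.IsProbabilityMeasure μ]
    [MeasureTheory.IsProbabilityMeasure μ'],
    IsTailTrivial μ → IsTailTrivial μ' →
    ∀ A : Set ((Sym2 (Site 3) → Prop) × (Sym2 (Site 3) → Prop)),
      @MeasurableSet _ (prodTailEvents (Sym2 (Site 3)) Prop) A → (μ.prod μ') A = 0 ∨ (μ.prod μ') A = 1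


/-! ## Card `infrared-saturation-dichotomy` -/

/-- Branch predicate: the infrared bound is SATURATED along the axis at every scale,
`⟨σ₀σ_{n e₁}⟩_{β_c} ≥ c/n` (the tree has the matching upper bound `≤ C/n`,
`criticalTwoPoint_bounds_holds`).  Its negation is `lim inf n ⟨σ₀σ_{ne₁}⟩ = 0`: dips below the
infrared bound at infinitely many scales. -/
def AxisSaturated : Prop :=
  ∃ c : ℝ, 0 < c ∧ ∀ n : ℕ, 1 ≤ n →
    c / n ≤ criticalTwoPoint 3 (Pi.single (0 : Fin 3) (n : ℤ))

/-- **First lemma of the card, branch (A):** saturation makes EVERY dyadic scale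
`(c,C)`-regular in the sense of ADC 2021 Def. 5.11 (`IsRegularScale`), with constants uniform in
the scale: doubling is immediate from `c/n ≤ S(ne₁) ≤ C/n`, P1/P3 by MMS
(`twoPointPlus_le_of_mul_supNorm_le`), P2 by the gradient estimate with bounded prefactor
(ADC Prop. 5.9; tree `TwoPointGradientEstimate`), P4 from `χ_{2n} ≍ n²`.  In this branch the
far-point tilt is flat (`h = 1 + O(r/‖x‖)`), the bubble grows linearly and the plain ADC/Panis
concentration closes the crux. -/
def SaturatedAllRegular : Prop :=
  AxisSaturated → ∃ c C : ℝ, 0 < c ∧ 0 < C ∧ ∀ k : ℕ, 1 ≤ k →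
    IsRegularScale (criticalTwoPoint 3) c C (2 ^ k)

/-- **Branch (B) resource:** failing saturation, there are arbitrarily large *dip scales* `M`
with `M² S(M e₁)² ≤ ε`; by MMS the sphere sum `∑_{‖w‖_∞ = M} S(w)² ≤ C M² S(Me₁)²` is then small —
exactly the quantity bounding (i) loop detours of the duplicated cluster (Panis 2024, proof of
Prop. 3.2, `∑_{u ∈ ∂Λ_M} ⟨σ_uσ_y⟩²`) and (ii) the Lieb-type first-exit bound for the sourced
backbone, `P^{0u}[Γ ⊄ Λ_M] ≤ ∑_{w ∈ ∂Λ_M} ⟨σ₀σ_w⟩_{Λ_M} ⟨σ_wσ_u⟩/⟨σ₀σ_u⟩`.  Localisation of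
connection events along dip scales is what lets Panis's `d = 3` mixing theorem act on them. -/
def DipScales : Prop :=
  ¬ AxisSaturated → ∀ ε : ℝ, 0 < ε → ∀ M₀ : ℕ, ∃ M : ℕ, M₀ ≤ M ∧
    (M : ℝ) ^ 2 * criticalTwoPoint 3 (Pi.single (0 : Fin 3) (M : ℤ)) ^ 2 ≤ ε

/-- The dichotomy itself is a tautology; recorded so that the two branch lemmas compose. -/
theorem saturation_dichotomy : AxisSaturated ∨ ¬ AxisSaturated := em _

/-! ## Sanity: the crux itself is importable by name (fixed, never restated). -/
example : Prop := Summit.CriticalPhenomena.Ising3DConformalLimit.Theses.EnergyNotSigmaSquared.RungOneAdjacentMerging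

end Summit.CriticalPhenomena.Ising3DConformalLimit.Cruxes.RungOneAdjacentMerging.Sketch
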